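import Summits.AtomisticToContinuum.Crystallization.Theorems.ChargedEnergyGapStencilChart
import HarnessLib

/-!
# ChargedEnergyGap · NODE 109A «ChartRows» — the u-FREE consequences of chart realisability (door D2a of memo CELLCHECKER-SPEC-g92 §6)

decomp-a2c lens-3 g92 (imports NODE 92 «StencilChart» only).

NODE 92 typed realisability of a depth tuple `dt` on the standard stencil as: every stencil point `p` has a UNIT direction `u` with
`realisRow ρ dt p q u : 2·dt p·⟪P_q − P_p, u⟫ ≤ ‖P_q − P_p‖² + dt p² − dt q²` for all stencil `q` (`P = stdPt ρ`).  The rows are linear in the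
unknown direction `u`; the cost/cap cells of NODES 107/108 carry no realisability hypothesis at all, and memo CELLCHECKER-SPEC-g92 §4
(FINDING «UNREALISABLE-OVERHANG-92») shows they cannot cover a neighbourhood of the worst family without one.  This node ELIMINATES `u`:

* `realisRow_aggregate` — for non-negative multipliers `α` over any finite family of rows of ONE point `p` (`0 ≤ dt p`, `‖u‖ = 1`):
  `0 ≤ Σᵢ αᵢ·(‖P_{qᵢ} − P_p‖² + dt p² − dt qᵢ²) + 2·dt p·N` whenever `‖Σᵢ αᵢ (P_{qᵢ} − P_p)‖ ≤ N` (sum the rows, Cauchy–Schwarz);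
* `vertexRow_of_chart` — the same read off `IsChartRealisable ρ dt` for a VERTEX `p = holeVertex 0 e` against the six vertices, entirely in
  coordinates: `N` is any number with `0 ≤ N`, `ρ²·Σₖ (Σ_{e'} α_{e'} ((holeVertex 0 e')ₖ − (holeVertex 0 e)ₖ))² ≤ N²`;
* `boxEmpty_of_vertexRow` — ★★ the CLOSED-FORM EMPTY-CELL CRITERION: on a depth box `lo ≤ dt ∘ holeVertex 0 ≤ hi` (with `0 ≤ lo`) and a frame
  scale `0 ≤ ρ ≤ ρ₁`, the aggregated row is bounded above by its value at `ρ = ρ₁`, `dt q = lo q` (`q ≠ p`) and `dt p ∈ {lo p, hi p}` (it is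
  increasing in `ρ`, decreasing in each `dt q`, convex in `dt p`); if both corner values are negative the box contains NO chart-realisable tuple.
  One certificate = a slot `e`, six multipliers `α ≥ 0` and a norm bound `n` — no LP, no search in the proof.

No new analysis: sums of NODE 92 rows, `abs_real_inner_le_norm`, and monotonicity of quadratics on intervals.  The exactness remark of the memo (for a
pole's rows the unit sphere may be replaced by the unit ball, so the family of all `α ≥ 0` is also SUFFICIENT) is not needed for soundness and is
not formalised here.

[SPLIT beneath (T¹ᶜ) (no EQUIV introduced) · Level-F primitive for the census: cost cells (N107/N108) below and across the admissibility envelope,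
EMPTY cells (this node; ℚ checker in NODE 109B «EmptyCell») beyond it · UNDECIDED(test = (D¹)) unchanged.] -/

noncomputable section
open scoped Classical
open Literature.MathematicalPhysics.StatisticalMechanics Literature.Geometry.DiscreteGeometry
open Summit.AtomisticToContinuum.Crystallization.Theses.PricedLinkCensus
open Summit.AtomisticToContinuum.Crystallization.Theorems.ChargedEnergyGapNegative

namespace Summit.AtomisticToContinuum.Crystallization.Theorems.ChargedEnergyGapChartDial

/-! ## §109.1 Coordinates of aggregated edge vectors -/
section Coordinates

/-- [formal bookkeeping] coordinates of `Σᵢ αᵢ • (P_{qᵢ} − P_p)`. -/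
theorem sum_smul_stdPt_sub_apply {ι : Type*} (T : Finset ι) (q : ι → Fin 3 → ℤ) (α : ι → ℝ) (ρ : ℝ) (p : Fin 3 → ℤ) (k : Fin 3) :
    (∑ i ∈ T, α i • (stdPt ρ (q i) - stdPt ρ p)) k = ρ * ∑ i ∈ T, α i * (((q i) k - p k : ℤ) : ℝ) := by
  have h : ∀ i, (α i • (stdPt ρ (q i) - stdPt ρ p)) k = α i * ((((q i) k - p k : ℤ) : ℝ) * ρ) := fun i => by
    rw [← stdPt_sub_apply]; rfl
  rw [Finset.mul_sum, show (∑ i ∈ T, α i • (stdPt ρ (q i) - stdPt ρ p)) k = ∑ i ∈ T, (α i • (stdPt ρ (q i) - stdPt ρ p)) k from by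
    simp [WithLp.ofLp_sum, Finset.sum_apply]]
  exact Finset.sum_congr rfl fun i _ => by rw [h]; ring

/-- ★ [formal bookkeeping] `‖Σᵢ αᵢ (P_{qᵢ} − P_p)‖² = ρ² Σₖ (Σᵢ αᵢ (qᵢ,ₖ − pₖ))²`. -/
theorem norm_sum_smul_stdPt_sub_sq {ι : Type*} (T : Finset ι) (q : ι → Fin 3 → ℤ) (α : ι → ℝ) (ρ : ℝ) (p : Fin 3 → ℤ) :
    ‖∑ i ∈ T, α i • (stdPt ρ (q i) - stdPt ρ p)‖ ^ 2 = ρ ^ 2 * ∑ k, (∑ i ∈ T, α i * (((q i) k - p k : ℤ) : ℝ)) ^ 2 := by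
  rw [EuclideanSpace.real_norm_sq_eq, Finset.mul_sum]
  refine Finset.sum_congr rfl fun k _ => ?_
  rw [sum_smul_stdPt_sub_apply]
  ring

/-- [formal bookkeeping] `⟪Σᵢ αᵢ • vᵢ, u⟫ = Σᵢ αᵢ ⟪vᵢ, u⟫`. -/
theorem inner_sum_smul {ι : Type*} (T : Finset ι) (α : ι → ℝ) (v : ι → E3) (u : E3) :
    inner ℝ (∑ i ∈ T, α i • v i) u = ∑ i ∈ T, α i * inner ℝ (v i) u := by
  rw [sum_inner]
  simp_rw [real_inner_smul_left]

end Coordinates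

/-! ## §109.2 Aggregating the rows of one stencil point -/
section Aggregate

/-- ★★ **THE AGGREGATED ROW**: summing the rows of `p` against `qᵢ` with weights `αᵢ ≥ 0` and bounding `⟪v, u⟫ ≥ −‖v‖` (`‖u‖ = 1`,
`0 ≤ dt p`) eliminates the direction: `0 ≤ Σᵢ αᵢ (‖P_{qᵢ} − P_p‖² + dt p² − dt qᵢ²) + 2·dt p·N` for any `N ≥ ‖Σᵢ αᵢ (P_{qᵢ} − P_p)‖`. -/
theorem realisRow_aggregate {ι : Type*} {ρ : ℝ} {dt : (Fin 3 → ℤ) → ℝ} {p : Fin 3 → ℤ} {u : E3} (hu : ‖u‖ = 1) (hp0 : 0 ≤ dt p)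
    (T : Finset ι) (q : ι → Fin 3 → ℤ) (α : ι → ℝ) (hα : ∀ i ∈ T, 0 ≤ α i) (hrow : ∀ i ∈ T, realisRow ρ dt p (q i) u)
    {N : ℝ} (hN : ‖∑ i ∈ T, α i • (stdPt ρ (q i) - stdPt ρ p)‖ ≤ N) :
    0 ≤ (∑ i ∈ T, α i * (‖stdPt ρ (q i) - stdPt ρ p‖ ^ 2 + dt p ^ 2 - dt (q i) ^ 2)) + 2 * dt p * N := by
  have h1 : ∑ i ∈ T, α i * (2 * dt p * inner ℝ (stdPt ρ (q i) - stdPt ρ p) u)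
      ≤ ∑ i ∈ T, α i * (‖stdPt ρ (q i) - stdPt ρ p‖ ^ 2 + dt p ^ 2 - dt (q i) ^ 2) :=
    Finset.sum_le_sum fun i hi => mul_le_mul_of_nonneg_left (hrow i hi) (hα i hi)
  have h2 : ∑ i ∈ T, α i * (2 * dt p * inner ℝ (stdPt ρ (q i) - stdPt ρ p) u)
      = 2 * dt p * inner ℝ (∑ i ∈ T, α i • (stdPt ρ (q i) - stdPt ρ p)) u := by
    rw [inner_sum_smul, Finset.mul_sum]
    exact Finset.sum_congr rfl fun i _ => by ring
  have h3 : -‖∑ i ∈ T, α i • (stdPt ρ (q i) - stdPt ρ p)‖ ≤ inner ℝ (∑ i ∈ T, α i • (stdPt ρ (q i) - stdPt ρ p)) u := by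
    have := abs_real_inner_le_norm (∑ i ∈ T, α i • (stdPt ρ (q i) - stdPt ρ p)) u
    rw [hu, mul_one] at this
    exact neg_le_of_abs_le this
  have h4 : 2 * dt p * (-N) ≤ 2 * dt p * inner ℝ (∑ i ∈ T, α i • (stdPt ρ (q i) - stdPt ρ p)) u :=
    mul_le_mul_of_nonneg_left (by linarith) (by linarith)
  linarith

/-- ★★ **VERTEX ROWS IN COORDINATES**: for a chart-realisable tuple, a vertex `p = holeVertex 0 e` with `0 ≤ dt p`, multipliers `α ≥ 0` on the
six vertices and any `N ≥ 0` with `ρ² Σₖ (Σ_{e'} α_{e'} ((holeVertex 0 e')ₖ − (holeVertex 0 e)ₖ))² ≤ N²`: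
`0 ≤ Σ_{e'} α_{e'} (ρ² Σₖ ((holeVertex 0 e')ₖ − (holeVertex 0 e)ₖ)² + dt p² − dt (holeVertex 0 e')²) + 2·dt p·N`. -/
theorem vertexRow_of_chart {ρ : ℝ} {dt : (Fin 3 → ℤ) → ℝ} (h : IsChartRealisable ρ dt) (e : Fin 3 × Bool)
    (hp0 : 0 ≤ dt (holeVertex 0 e)) (α : Fin 3 × Bool → ℝ) (hα : ∀ e', 0 ≤ α e') {N : ℝ} (hN0 : 0 ≤ N)
    (hN : ρ ^ 2 * ∑ k, (∑ e', α e' * (((holeVertex 0 e') k - (holeVertex 0 e) k : ℤ) : ℝ)) ^ 2 ≤ N ^ 2) :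
    0 ≤ (∑ e', α e' * (ρ ^ 2 * (∑ k, (((holeVertex 0 e') k - (holeVertex 0 e) k : ℤ) : ℝ) ^ 2)
          + dt (holeVertex 0 e) ^ 2 - dt (holeVertex 0 e') ^ 2)) + 2 * dt (holeVertex 0 e) * N := by
  obtain ⟨u, hu, hrow⟩ := h (holeVertex 0 e) (mem_stencil_vertex 0 e)
  have hnorm : ‖∑ e' ∈ Finset.univ, α e' • (stdPt ρ (holeVertex 0 e') - stdPt ρ (holeVertex 0 e))‖ ≤ N := by
    refine abs_le_of_sq_le_sq' ?_ hN0 |>.2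
    rw [norm_sum_smul_stdPt_sub_sq]
    exact hN
  have := realisRow_aggregate hu hp0 Finset.univ (fun e' => holeVertex 0 e') α (fun e' _ => hα e')
    (fun e' _ => hrow _ (mem_stencil_vertex 0 e')) hnorm
  simp only [norm_stdPt_sub_sq] at this
  exact this

end Aggregate

/-! ## §109.3 The closed-form empty-cell criterion -/
section EmptyCell

/-- [formal bookkeeping] `A·x² + B·x` with `A, B ≥ 0` is monotone on `0 ≤ x`: its value on `[0, b]` is at most the value at `b`. -/
theorem quad_le_endpoint {A B b x : ℝ} (hA : 0 ≤ A) (hB : 0 ≤ B) (hx0 : 0 ≤ x) (hxb : x ≤ b) :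
    A * x ^ 2 + B * x ≤ A * b ^ 2 + B * b := by
  nlinarith [mul_le_mul_of_nonneg_left hxb hA, pow_le_pow_left₀ hx0 hxb 2, mul_le_mul_of_nonneg_left hxb hB]

/-- ★★★ **EMPTY-CELL CRITERION (closed form)**.  Data: a slot `e` (the row owner `p = holeVertex 0 e`), multipliers `α ≥ 0` on the six vertex
slots, a norm bound `n ≥ 0` with `Σₖ (Σ_{e'} α_{e'} ((holeVertex 0 e')ₖ − (holeVertex 0 e)ₖ))² ≤ n²`, a depth box `0 ≤ lo ≤ dt ≤ hi` and a
scale bound `0 ≤ ρ ≤ ρ₁`.  With `G e' = Σₖ ((holeVertex 0 e')ₖ − (holeVertex 0 e)ₖ)²` and `S = Σ α`, the aggregated row of §109.2 is at most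
`V = ρ₁²·Σ α G + S·(hi e)² − Σ_{e'} α_{e'} (lo e')² + 2·(hi e)·ρ₁·n` on the box (increasing in `ρ` and in `dt p`, decreasing in each `dt q`) —
the row evaluated at the SINGLE tuple `(dt p = hi e, dt q = lo q, ρ = ρ₁)`.  If `V < 0`, NO tuple in the box is chart-realisable at any such `ρ`.
(For a pole `p` the multiplier family is exact, so a box is certifiable this way iff that single tuple gives `p` no foot.) -/
theorem boxEmpty_of_vertexRow {ρ ρ1 : ℝ} {dt : (Fin 3 → ℤ) → ℝ} {lo hi : Fin 3 × Bool → ℝ} (e : Fin 3 × Bool)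
    (α : Fin 3 × Bool → ℝ) (hα : ∀ e', 0 ≤ α e') {n : ℝ} (hn0 : 0 ≤ n)
    (hn : ∑ k, (∑ e', α e' * (((holeVertex 0 e') k - (holeVertex 0 e) k : ℤ) : ℝ)) ^ 2 ≤ n ^ 2)
    (hρ0 : 0 ≤ ρ) (hρ1 : ρ ≤ ρ1) (hlo : ∀ q, 0 ≤ lo q) (hbox : ∀ q, lo q ≤ dt (holeVertex 0 q) ∧ dt (holeVertex 0 q) ≤ hi q)
    (hV : ρ1 ^ 2 * (∑ e', α e' * ∑ k, (((holeVertex 0 e') k - (holeVertex 0 e) k : ℤ) : ℝ) ^ 2)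
        + (∑ e', α e') * hi e ^ 2 - (∑ e', α e' * lo e' ^ 2) + 2 * hi e * ρ1 * n < 0) :
    ¬ IsChartRealisable ρ dt := by
  intro h
  set p := holeVertex 0 e with hp
  have hp0 : 0 ≤ dt p := (hlo e).trans (hbox e).1
  -- the aggregated row with N = ρ1 · n
  have hN0 : 0 ≤ ρ1 * n := mul_nonneg (hρ0.trans hρ1) hn0
  have hN : ρ ^ 2 * ∑ k, (∑ e', α e' * (((holeVertex 0 e') k - (holeVertex 0 e) k : ℤ) : ℝ)) ^ 2 ≤ (ρ1 * n) ^ 2 := by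
    rw [mul_pow]
    exact mul_le_mul (pow_le_pow_left₀ hρ0 hρ1 2) hn (Finset.sum_nonneg fun _ _ => sq_nonneg _) (sq_nonneg _)
  have hrow := vertexRow_of_chart h e hp0 α hα hN0 hN
  -- bound each summand: ρ² G ≤ ρ1² G, −dt q² ≤ −lo q²
  have hG0 : ∀ e', (0 : ℝ) ≤ ∑ k, (((holeVertex 0 e') k - (holeVertex 0 e) k : ℤ) : ℝ) ^ 2 := fun _ =>
    Finset.sum_nonneg fun _ _ => sq_nonneg _
  have hρsq : ρ ^ 2 ≤ ρ1 ^ 2 := pow_le_pow_left₀ hρ0 hρ1 2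
  have hsum : ∑ e', α e' * (ρ ^ 2 * (∑ k, (((holeVertex 0 e') k - (holeVertex 0 e) k : ℤ) : ℝ) ^ 2)
          + dt p ^ 2 - dt (holeVertex 0 e') ^ 2)
      ≤ ∑ e', α e' * (ρ1 ^ 2 * (∑ k, (((holeVertex 0 e') k - (holeVertex 0 e) k : ℤ) : ℝ) ^ 2)
          + dt p ^ 2 - lo e' ^ 2) := by
    refine Finset.sum_le_sum fun e' _ => mul_le_mul_of_nonneg_left ?_ (hα e')
    have h1 : ρ ^ 2 * (∑ k, (((holeVertex 0 e') k - (holeVertex 0 e) k : ℤ) : ℝ) ^ 2)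
        ≤ ρ1 ^ 2 * (∑ k, (((holeVertex 0 e') k - (holeVertex 0 e) k : ℤ) : ℝ) ^ 2) :=
      mul_le_mul_of_nonneg_right hρsq (hG0 e')
    have h2 : lo e' ^ 2 ≤ dt (holeVertex 0 e') ^ 2 := pow_le_pow_left₀ (hlo e') (hbox e').1 2
    linarith
  -- rewrite the majorant as a quadratic in x = dt p and use the endpoint bound
  have hexp : ∑ e', α e' * (ρ1 ^ 2 * (∑ k, (((holeVertex 0 e') k - (holeVertex 0 e) k : ℤ) : ℝ) ^ 2)
          + dt p ^ 2 - lo e' ^ 2) + 2 * dt p * (ρ1 * n)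
      = (∑ e', α e') * dt p ^ 2 + (2 * ρ1 * n) * dt p
        + (ρ1 ^ 2 * (∑ e', α e' * ∑ k, (((holeVertex 0 e') k - (holeVertex 0 e) k : ℤ) : ℝ) ^ 2)
           - ∑ e', α e' * lo e' ^ 2) := by
    have : ∀ e', α e' * (ρ1 ^ 2 * (∑ k, (((holeVertex 0 e') k - (holeVertex 0 e) k : ℤ) : ℝ) ^ 2) + dt p ^ 2 - lo e' ^ 2)
        = α e' * dt p ^ 2 + (ρ1 ^ 2 * (α e' * ∑ k, (((holeVertex 0 e') k - (holeVertex 0 e) k : ℤ) : ℝ) ^ 2) - α e' * lo e' ^ 2) :=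
      fun e' => by ring
    rw [Finset.sum_congr rfl fun e' _ => this e', Finset.sum_add_distrib, Finset.sum_sub_distrib, ← Finset.sum_mul,
      ← Finset.mul_sum]
    ring
  have hS0 : 0 ≤ ∑ e', α e' := Finset.sum_nonneg fun e' _ => hα e'
  have hquad := quad_le_endpoint (B := 2 * ρ1 * n) hS0 (by nlinarith [hρ0.trans hρ1, hn0]) hp0 (hbox e).2
  rw [← hp] at hrow hsum hexp
  linarith [hrow, hsum, hexp, hquad, hV]

end EmptyCell

end Summit.AtomisticToContinuum.Crystallization.Theorems.ChargedEnergyGapChartDial
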